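import Mathlib
import Summits.Ventures.PercRepro2.A3LeafGlueFibres

/-!
# A pinned pendant leaf is invisible to the exploration of its attachment vertex — the sums
(blind cell PercRepro2, night-1 g32; proofs/NIGHT1-G32.md §3; the fibres are A3LeafGlueFibres.lean)

Let `a₃` be a leaf attached to `v` by the edge `f` of weight `p f = 1` (the situation the leaf expansion
`btw_leaf_free` creates at `v` under `p[f ↦ 1]`).  The fibres of the `v`-exploration are the fibres of
the same exploration on the graph with `f` re-routed to a loop at `a₃` (`glueLoop`) with `a₃` inserted
(A3LeafGlueFibres), so every fibre sum of `btw` and `FMfun` at `v` is the same on both graphs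
(`sum_reindex_insert`, the fibre bijection `W ↦ insert a₃ W`; `sum_fibre_glue` for a generic term in the
fibre masses), and so are the masses `P(Q)`, `P(PD_v)`, `m_x`, `γ`, `γ₀`:

  **`btw_glue`**: `btw(v)` on `G` `=` `btw(v)` on `G[f ↦ loop at a₃]`;  **`FMfun_glue`** likewise;
  `A3Between_glue_iff`.

USE: after the leaf expansion at `a₃` the attachment vertex `v` carries the pinned leaf; gluing removes
it, so the g30/g31 class theorems at `v` (a leaf at a mark, …) apply — the pendant PATH classes of
(MEANS-a₃) (A3PendantPath.lean).  Standard axioms.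
-/

namespace Summit.Ventures.PercRepro2

open UnionCluster CovForm

namespace CovForm

namespace A3Fibre

/-! ## Reindexing the fibre sums by `W ↦ insert a₃ W` -/

section Reindex

variable {V : Type*} [Fintype V] [DecidableEq V] {R : Type*} [AddCommMonoid R]

/-- **Fibre reindexing**: if `F` vanishes off the sets containing `a`, `F'` vanishes on them, and
`F (insert a W) = F' W` for `a ∉ W`, the two sums agree. -/
lemma sum_reindex_insert (a : V) (F F' : Finset V → R) (hF : ∀ W, a ∉ W → F W = 0)
    (hF' : ∀ W, a ∈ W → F' W = 0) (h : ∀ W, a ∉ W → F (insert a W) = F' W) :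
    ∑ W, F W = ∑ W, F' W := by
  have hu : (Finset.univ : Finset V) = insert a (Finset.univ.erase a) :=
    (Finset.insert_erase (Finset.mem_univ a)).symm
  have ha : a ∉ Finset.univ.erase a := Finset.notMem_erase a _
  have key : ∀ G : Finset V → R, ∑ W, G W =
      ∑ t ∈ (Finset.univ.erase a).powerset, G t + ∑ t ∈ (Finset.univ.erase a).powerset, G (insert a t) := by
    intro G
    rw [← Finset.sum_powerset_insert ha, ← hu, Finset.powerset_univ]
  have hsub : ∀ t ∈ (Finset.univ.erase a).powerset, a ∉ t := fun t ht hat =>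
    ha (Finset.mem_powerset.1 ht hat)
  rw [key F, key F']
  rw [Finset.sum_eq_zero (fun t ht => hF t (hsub t ht)),
    Finset.sum_eq_zero (fun t _ => hF' _ (Finset.mem_insert_self a t)), zero_add, add_zero]
  exact Finset.sum_congr rfl fun t ht => h t (hsub t ht)

end Reindex

/-! ## `btw` and `FMfun` at `v` do not see the pinned leaf -/

section Glue

variable {V : Type*} {E : Type*} [Fintype V] [DecidableEq V] [Fintype E] [DecidableEq E]
  {R : Type*} [Field R] [LinearOrder R] [IsStrictOrderedRing R]
  {ends : E → Sym2 V} {f : E} {a₃ v : V}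

omit [Fintype V] [Fintype E] [DecidableEq E] [LinearOrder R] [IsStrictOrderedRing R] in
/-- `s3` does not see `a₃`. -/
lemma s3_insert_leaf {a₁ a₂ : V} (h31 : a₃ ≠ a₁) (h32 : a₃ ≠ a₂) (W : Finset V) :
    (s3 a₁ a₂ (insert a₃ W) : R) = s3 a₁ a₂ W := by
  unfold s3
  simp [Finset.mem_insert, Ne.symm h31, Ne.symm h32]

omit [Fintype V] [Fintype E] [DecidableEq E] [Field R] [LinearOrder R] [IsStrictOrderedRing R] in
/-- The `A`-condition does not see `a₃`. -/
lemma fibresA_cond_insert_leaf {a₁ a₂ : V} (h31 : a₃ ≠ a₁) (h32 : a₃ ≠ a₂) (W : Finset V) :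
    (a₁ ∉ insert a₃ W ∧ a₂ ∉ insert a₃ W) ↔ (a₁ ∉ W ∧ a₂ ∉ W) := by
  simp [Finset.mem_insert, Ne.symm h31, Ne.symm h32]

/-- **The generic fibre sum transfers**: for any term `T` built from the fibre masses (and from `W` only
through `s3` and the `A`-condition, i.e. invariant under `insert a₃`) that vanishes on null fibres. -/
lemma sum_fibre_glue {p : E → R} (hp : IsProbVec p) (h1 : p f = 1) (hf : ends f = s(a₃, v))
    (hleaf : ∀ e, a₃ ∈ ends e → e = f) (h3v : a₃ ≠ v) {o a₁ a₂ b : V} (h31 : a₃ ≠ a₁) (h32 : a₃ ≠ a₂)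
    (ho : o ≠ a₃) (hb : b ≠ a₃) (T : Finset V → R → R → R → R → R → R)
    (hT0 : ∀ W, T W 0 0 0 0 0 = 0) (hTins : ∀ W, T (insert a₃ W) = T W) :
    ∑ W, T W (mW p ends a₁ a₂ v W) (Ssig p ends a₁ a₂ v b W) (Ssig p ends a₁ a₂ v o W)
        (Su p ends a₁ a₂ v b W) (Su p ends a₁ a₂ v o W) =
      ∑ W, T W (mW p (glueLoop ends f a₃) a₁ a₂ v W) (Ssig p (glueLoop ends f a₃) a₁ a₂ v b W)
        (Ssig p (glueLoop ends f a₃) a₁ a₂ v o W) (Su p (glueLoop ends f a₃) a₁ a₂ v b W)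
        (Su p (glueLoop ends f a₃) a₁ a₂ v o W) := by
  refine sum_reindex_insert a₃ _ _ ?_ ?_ ?_
  · intro W hW
    have hm := mW_eq_zero_of_notMem_glue h1 hf a₁ a₂ hW
    rw [hm, Ssig_eq_zero_of_mW_eq_zero hp ends a₁ a₂ v b W hm,
      Ssig_eq_zero_of_mW_eq_zero hp ends a₁ a₂ v o W hm, Su_eq_zero_of_mW_eq_zero hp ends a₁ a₂ v b W hm,
      Su_eq_zero_of_mW_eq_zero hp ends a₁ a₂ v o W hm]
    exact hT0 W
  · intro W hW
    have hm := mW_glue_eq_zero_of_mem p hleaf h3v a₁ a₂ hW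
    rw [hm, Ssig_eq_zero_of_mW_eq_zero hp _ a₁ a₂ v b W hm,
      Ssig_eq_zero_of_mW_eq_zero hp _ a₁ a₂ v o W hm, Su_eq_zero_of_mW_eq_zero hp _ a₁ a₂ v b W hm,
      Su_eq_zero_of_mW_eq_zero hp _ a₁ a₂ v o W hm]
    exact hT0 W
  · intro W hW
    rw [mW_glue_insert h1 hf hleaf h3v h31 h32 hW, Ssig_glue_insert h1 hf hleaf h3v h31 h32 hb hW,
      Ssig_glue_insert h1 hf hleaf h3v h31 h32 ho hW, Su_glue_insert h1 hf hleaf h3v h31 h32 hb hW,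
      Su_glue_insert h1 hf hleaf h3v h31 h32 ho hW, hTins W]

omit [Fintype V] [DecidableEq V] [LinearOrder R] [IsStrictOrderedRing R] in
/-- `γ` at `v` is the same on both graphs. -/
lemma gamma_glue (p : E → R) (hf : ends f = s(a₃, v)) (hleaf : ∀ e, a₃ ∈ ends e → e = f)
    (h3v : a₃ ≠ v) {o a₁ a₂ : V} (h31 : a₃ ≠ a₁) (h32 : a₃ ≠ a₂) (ho : o ≠ a₃) :
    gamma p (glueLoop ends f a₃) o a₁ a₂ v = gamma p ends o a₁ a₂ v := by
  unfold gamma Do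
  rw [probPDconn_glue p hf hleaf h3v h31 h32 (Ne.symm h31) ho,
    probPDconn_glue p hf hleaf h3v h31 h32 (Ne.symm h32) ho, probPD_glue p hf hleaf h3v h31 h32]

omit [Fintype V] [DecidableEq V] [LinearOrder R] [IsStrictOrderedRing R] in
/-- `γ₀` is the same on both graphs. -/
lemma gamma0_glue (p : E → R) (hf : ends f = s(a₃, v)) (hleaf : ∀ e, a₃ ∈ ends e → e = f)
    (h3v : a₃ ≠ v) {o a₁ a₂ : V} (h31 : a₃ ≠ a₁) (h32 : a₃ ≠ a₂) (ho : o ≠ a₃) :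
    gamma0 p (glueLoop ends f a₃) o a₁ a₂ = gamma0 p ends o a₁ a₂ := by
  unfold gamma0 LeafStep.mU
  rw [probQconn_glue p hf hleaf h3v h31 h32 (Ne.symm h31) ho,
    probQconn_glue p hf hleaf h3v h31 h32 (Ne.symm h32) ho, probQ_glue p hf hleaf h3v h31 h32]

omit [Fintype V] [DecidableEq V] [LinearOrder R] [IsStrictOrderedRing R] in
/-- `m_x` is the same on both graphs. -/
lemma mU_glue (p : E → R) (hf : ends f = s(a₃, v)) (hleaf : ∀ e, a₃ ∈ ends e → e = f)
    (h3v : a₃ ≠ v) {a₁ a₂ x : V} (h31 : a₃ ≠ a₁) (h32 : a₃ ≠ a₂) (hx : x ≠ a₃) :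
    LeafStep.mU p (glueLoop ends f a₃) a₁ a₂ x = LeafStep.mU p ends a₁ a₂ x := by
  unfold LeafStep.mU
  rw [probQconn_glue p hf hleaf h3v h31 h32 (Ne.symm h31) hx,
    probQconn_glue p hf hleaf h3v h31 h32 (Ne.symm h32) hx]

/-- **`btw` at `v` does not see the pinned leaf.** -/
theorem btw_glue {p : E → R} (hp : IsProbVec p) (h1 : p f = 1) (hf : ends f = s(a₃, v))
    (hleaf : ∀ e, a₃ ∈ ends e → e = f) (h3v : a₃ ≠ v) {o a₁ a₂ b : V} (h31 : a₃ ≠ a₁) (h32 : a₃ ≠ a₂)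
    (ho : o ≠ a₃) (hb : b ≠ a₃) :
    btw p ends o a₁ a₂ v b = btw p (glueLoop ends f a₃) o a₁ a₂ v b := by
  unfold btw SF
  rw [gamma_glue p hf hleaf h3v h31 h32 ho, probQ_glue p hf hleaf h3v h31 h32,
    probPD_glue p hf hleaf h3v h31 h32, fibresA, Finset.sum_filter, Finset.sum_filter,
    Finset.sum_filter, Finset.sum_filter, Finset.sum_filter, Finset.sum_filter]
  rw [sum_fibre_glue hp h1 hf hleaf h3v h31 h32 ho hb
      (fun W m sb so _ uo => sb * (so + s3 a₁ a₂ W * (gamma p ends o a₁ a₂ v * m - uo)) / m)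
      (fun W => by simp) (fun W => by funext m sb so ub uo; rw [s3_insert_leaf h31 h32]),
    sum_fibre_glue hp h1 hf hleaf h3v h31 h32 ho hb (fun _ _ sb _ _ _ => sb) (fun W => rfl)
      (fun W => rfl),
    sum_fibre_glue hp h1 hf hleaf h3v h31 h32 ho hb
      (fun W m _ so _ uo => so + s3 a₁ a₂ W * (gamma p ends o a₁ a₂ v * m - uo))
      (fun W => by simp) (fun W => by funext m sb so ub uo; rw [s3_insert_leaf h31 h32]),
    sum_fibre_glue hp h1 hf hleaf h3v h31 h32 ho hb
      (fun W m _ _ ub uo => if a₁ ∉ W ∧ a₂ ∉ W then ub * uo / m else 0)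
      (fun W => by simp) (fun W => by funext m sb so ub uo; simp only [fibresA_cond_insert_leaf h31 h32]),
    sum_fibre_glue hp h1 hf hleaf h3v h31 h32 ho hb
      (fun W _ _ _ ub _ => if a₁ ∉ W ∧ a₂ ∉ W then ub else 0)
      (fun W => by simp) (fun W => by funext m sb so ub uo; simp only [fibresA_cond_insert_leaf h31 h32]),
    sum_fibre_glue hp h1 hf hleaf h3v h31 h32 ho hb
      (fun W _ _ _ _ uo => if a₁ ∉ W ∧ a₂ ∉ W then uo else 0)
      (fun W => by simp) (fun W => by funext m sb so ub uo; simp only [fibresA_cond_insert_leaf h31 h32])]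

/-- **`FMfun` at `v` does not see the pinned leaf.** -/
theorem FMfun_glue {p : E → R} (hp : IsProbVec p) (h1 : p f = 1) (hf : ends f = s(a₃, v))
    (hleaf : ∀ e, a₃ ∈ ends e → e = f) (h3v : a₃ ≠ v) {o a₁ a₂ b : V} (h31 : a₃ ≠ a₁) (h32 : a₃ ≠ a₂)
    (ho : o ≠ a₃) (hb : b ≠ a₃) :
    FMfun p ends o a₁ a₂ v b = FMfun p (glueLoop ends f a₃) o a₁ a₂ v b := by
  unfold FMfun RootEdge.SFg
  rw [gamma0_glue p hf hleaf h3v h31 h32 ho, probQ_glue p hf hleaf h3v h31 h32,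
    probPD_glue p hf hleaf h3v h31 h32, mU_glue p hf hleaf h3v h31 h32 ho, mU_glue p hf hleaf h3v h31 h32 hb,
    fibresA, Finset.sum_filter, Finset.sum_filter, Finset.sum_filter, Finset.sum_filter,
    Finset.sum_filter, Finset.sum_filter]
  rw [sum_fibre_glue hp h1 hf hleaf h3v h31 h32 ho hb
      (fun W m sb so _ uo => sb * (so + s3 a₁ a₂ W * (gamma0 p ends o a₁ a₂ * m - uo)) / m)
      (fun W => by simp) (fun W => by funext m sb so ub uo; rw [s3_insert_leaf h31 h32]),
    sum_fibre_glue hp h1 hf hleaf h3v h31 h32 ho hb (fun _ _ sb _ _ _ => sb) (fun W => rfl)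
      (fun W => rfl),
    sum_fibre_glue hp h1 hf hleaf h3v h31 h32 ho hb
      (fun W m _ so _ uo => so + s3 a₁ a₂ W * (gamma0 p ends o a₁ a₂ * m - uo))
      (fun W => by simp) (fun W => by funext m sb so ub uo; rw [s3_insert_leaf h31 h32]),
    sum_fibre_glue hp h1 hf hleaf h3v h31 h32 ho hb
      (fun W m _ _ ub uo => if a₁ ∉ W ∧ a₂ ∉ W then ub * uo / m else 0)
      (fun W => by simp) (fun W => by funext m sb so ub uo; simp only [fibresA_cond_insert_leaf h31 h32]),
    sum_fibre_glue hp h1 hf hleaf h3v h31 h32 ho hb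
      (fun W _ _ _ ub _ => if a₁ ∉ W ∧ a₂ ∉ W then ub else 0)
      (fun W => by simp) (fun W => by funext m sb so ub uo; simp only [fibresA_cond_insert_leaf h31 h32]),
    sum_fibre_glue hp h1 hf hleaf h3v h31 h32 ho hb
      (fun W _ _ _ _ uo => if a₁ ∉ W ∧ a₂ ∉ W then uo else 0)
      (fun W => by simp) (fun W => by funext m sb so ub uo; simp only [fibresA_cond_insert_leaf h31 h32])]

/-- **(MEANS-a₃) at `v` does not see the pinned leaf.** -/
theorem A3Between_glue_iff {p : E → R} (hp : IsProbVec p) (h1 : p f = 1) (hf : ends f = s(a₃, v))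
    (hleaf : ∀ e, a₃ ∈ ends e → e = f) (h3v : a₃ ≠ v) {o a₁ a₂ b : V} (h31 : a₃ ≠ a₁) (h32 : a₃ ≠ a₂)
    (ho : o ≠ a₃) (hb : b ≠ a₃) :
    A3Between p ends o a₁ a₂ v b ↔ A3Between p (glueLoop ends f a₃) o a₁ a₂ v b := by
  unfold A3Between
  rw [btw_glue hp h1 hf hleaf h3v h31 h32 ho hb]

end Glue

end A3Fibre

end CovForm

end Summit.Ventures.PercRepro2
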